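import Summits.CriticalPhenomena.PercolationContinuityZ3.Theorems.PercNearOneGluingNoHeavyLowerTailSahiOneStepTwoChainPhi
import Mathlib.Algebra.BigOperators.Ring.Finset
import Mathlib.Algebra.Order.BigOperators.Group.Finset
import Mathlib.Tactic.Ring
import HarnessLib

/-!
# The TWO-CHAIN COLLAPSE THEOREM in profile form (gen-20's conjecture 2CH / CWP, all levels)

Support file (prover prim-ineq-prove-3 gen 24; `--supports stmt-CriticalPhenomena-4575`; memo
`run/shared/lean/prim/prim-ineq-prove-3/FINDING-G24-TWO-CHAIN.md` §1).  No definitions, no sorries.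

Setting: a finite chain of column indices `k ∈ {0,…,K}` with weights `c k ≥ 0`, `Σ c = 1`, and three nondecreasing `[0,1]`-valued
column profiles `x, y, z` (the masses, in the second chain, of the sections of two up-sets `A, B` and of the up-set `H = Lᶜ`).
With `m = x∧y∧z`, `x″ = (x−z)₊`, `y″ = (y−z)₊` the two-chain identity
`μ(L)·[Cov(1_A,1_B) − μ(L)·Cov(1_A,1_B | L)] = E[m]·E[1−z] + E[x″]·E[y″] − E[x]·E[y]·E[1−z]`  (`E` = `c`-average)
reduces `Cov ≥ μ(L)·Cov_L` on a product of two chains (any down-set `L`, any product weights) to the nonnegativity of the right-hand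
side, which is `profile_nonneg` below: the cubic form `Σ_{i,j,k} c_i c_j c_k φ(i,j,k)` is symmetrised (`triple_sum_symm`) and each
symmetrised coefficient is an instance of LEMMA Φ (`phi3_nonneg`).  No log-concavity of `c` is needed.
-/

namespace Summit.CriticalPhenomena.PercolationContinuityZ3.Theorems

namespace SahiOneStep

namespace TwoChain

open Finset

/-- Expansion of a product of three sums over the same index set into a triple sum. [this work] -/
theorem triple_expand (S : Finset ℕ) (f g h : ℕ → ℝ) :
    (∑ i ∈ S, f i) * (∑ j ∈ S, g j) * (∑ k ∈ S, h k) = ∑ i ∈ S, ∑ j ∈ S, ∑ k ∈ S, f i * g j * h k := by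
  rw [Finset.sum_mul_sum, Finset.sum_mul]
  refine Finset.sum_congr rfl (fun i _ => ?_)
  rw [Finset.sum_mul]
  refine Finset.sum_congr rfl (fun j _ => ?_)
  rw [Finset.mul_sum]

/-- Symmetrisation of a triple sum over a common index set: `6·Σ w(i,j,k) = Σ [w over the six orderings]`. [this work] -/
theorem triple_sum_symm (S : Finset ℕ) (w : ℕ → ℕ → ℕ → ℝ) :
    6 * ∑ i ∈ S, ∑ j ∈ S, ∑ k ∈ S, w i j k
      = ∑ i ∈ S, ∑ j ∈ S, ∑ k ∈ S,
          (w i j k + w i k j + w j i k + w j k i + w k i j + w k j i) := by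
  -- inner swap: `Σ_i Σ_j Σ_k u i j k = Σ_i Σ_k Σ_j u i j k`
  have inner : ∀ u : ℕ → ℕ → ℕ → ℝ,
      ∑ i ∈ S, ∑ j ∈ S, ∑ k ∈ S, u i j k = ∑ i ∈ S, ∑ k ∈ S, ∑ j ∈ S, u i j k :=
    fun u => Finset.sum_congr rfl (fun i _ => Finset.sum_comm)
  -- outer swap: `Σ_i Σ_j F i j = Σ_j Σ_i F i j`
  have h1 : ∑ i ∈ S, ∑ j ∈ S, ∑ k ∈ S, w i k j = ∑ i ∈ S, ∑ j ∈ S, ∑ k ∈ S, w i j k := by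
    rw [inner]
  have h2 : ∑ i ∈ S, ∑ j ∈ S, ∑ k ∈ S, w j i k = ∑ i ∈ S, ∑ j ∈ S, ∑ k ∈ S, w i j k := by
    rw [Finset.sum_comm]
  have h3 : ∑ i ∈ S, ∑ j ∈ S, ∑ k ∈ S, w j k i = ∑ i ∈ S, ∑ j ∈ S, ∑ k ∈ S, w i j k := by
    rw [Finset.sum_comm, inner]
  have h4 : ∑ i ∈ S, ∑ j ∈ S, ∑ k ∈ S, w k i j = ∑ i ∈ S, ∑ j ∈ S, ∑ k ∈ S, w i j k := by
    rw [inner, Finset.sum_comm]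
  have h5 : ∑ i ∈ S, ∑ j ∈ S, ∑ k ∈ S, w k j i = ∑ i ∈ S, ∑ j ∈ S, ∑ k ∈ S, w i j k := by
    rw [inner, Finset.sum_comm, inner]
  simp only [Finset.sum_add_distrib]
  rw [h1, h2, h3, h4, h5]
  ring

/-- **TWO-CHAIN COLLAPSE THEOREM, profile form** (memo §1; gen-20 conjecture 2CH/CWP for every number of levels): for weights
`c ≥ 0` with `Σ_{k ≤ K} c k = 1` and nondecreasing `x, y, z : ℕ → [0,1]`,
`E[x∧y∧z]·E[1−z] + E[(x−z)₊]·E[(y−z)₊] ≥ E[x]·E[y]·E[1−z]`.  [this work] -/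
theorem profile_nonneg (K : ℕ) (c x y z : ℕ → ℝ) (hc : ∀ k, 0 ≤ c k) (hc1 : ∑ k ∈ range (K + 1), c k = 1)
    (hx : Monotone x) (hy : Monotone y) (hz : Monotone z)
    (hx0 : ∀ k, 0 ≤ x k) (hy0 : ∀ k, 0 ≤ y k) (hz0 : ∀ k, 0 ≤ z k) (hx1 : ∀ k, x k ≤ 1) (hy1 : ∀ k, y k ≤ 1) (hz1 : ∀ k, z k ≤ 1) :
    0 ≤ (∑ k ∈ range (K + 1), c k * min (min (x k) (y k)) (z k)) * (∑ k ∈ range (K + 1), c k * (1 - z k))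
        + (∑ k ∈ range (K + 1), c k * max (x k - z k) 0) * (∑ k ∈ range (K + 1), c k * max (y k - z k) 0)
        - (∑ k ∈ range (K + 1), c k * x k) * (∑ k ∈ range (K + 1), c k * y k) * (∑ k ∈ range (K + 1), c k * (1 - z k)) := by
  set S := range (K + 1) with hS
  -- split the raw profiles: `x = x∧z + (x−z)₊`, `y = y∧z + (y−z)₊`
  have splitx : ∀ n, min (x n) (z n) + max (x n - z n) 0 = x n := by
    intro n
    rcases le_total (x n) (z n) with h | h
    · rw [min_eq_left h, max_eq_right (sub_nonpos.2 h)]; ring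
    · rw [min_eq_right h, max_eq_left (sub_nonneg.2 h)]; ring
  have splity : ∀ n, min (y n) (z n) + max (y n - z n) 0 = y n := by
    intro n
    rcases le_total (y n) (z n) with h | h
    · rw [min_eq_left h, max_eq_right (sub_nonpos.2 h)]; ring
    · rw [min_eq_right h, max_eq_left (sub_nonneg.2 h)]; ring
  have ex' : ∑ k ∈ S, c k * x k = ∑ k ∈ S, c k * (min (x k) (z k) + max (x k - z k) 0) :=
    Finset.sum_congr rfl (fun k _ => by rw [splitx k])
  have ey' : ∑ k ∈ S, c k * y k = ∑ k ∈ S, c k * (min (y k) (z k) + max (y k - z k) 0) :=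
    Finset.sum_congr rfl (fun k _ => by rw [splity k])
  rw [ex', ey']
  -- the one-slot summand
  set φ : ℕ → ℕ → ℕ → ℝ := fun i j k =>
    c i * c j * c k * (min (min (x i) (y i)) (z i) * (1 - z k) + max (x i - z i) 0 * max (y j - z j) 0
      - (min (x i) (z i) + max (x i - z i) 0) * (min (y j) (z j) + max (y j - z j) 0) * (1 - z k))
    with hφ
  -- Step 1: the functional is the triple sum of `φ`
  have step1 : (∑ k ∈ S, c k * min (min (x k) (y k)) (z k)) * (∑ k ∈ S, c k * (1 - z k))
        + (∑ k ∈ S, c k * max (x k - z k) 0) * (∑ k ∈ S, c k * max (y k - z k) 0)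
        - (∑ k ∈ S, c k * (min (x k) (z k) + max (x k - z k) 0)) * (∑ k ∈ S, c k * (min (y k) (z k) + max (y k - z k) 0))
            * (∑ k ∈ S, c k * (1 - z k))
      = ∑ i ∈ S, ∑ j ∈ S, ∑ k ∈ S, φ i j k := by
    have e1 : (∑ k ∈ S, c k * min (min (x k) (y k)) (z k)) * (∑ k ∈ S, c k * (1 - z k))
        = (∑ i ∈ S, c i * min (min (x i) (y i)) (z i)) * (∑ j ∈ S, c j) * (∑ k ∈ S, c k * (1 - z k)) := by
      rw [hc1, mul_one]
    have e2 : (∑ k ∈ S, c k * max (x k - z k) 0) * (∑ k ∈ S, c k * max (y k - z k) 0)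
        = (∑ i ∈ S, c i * max (x i - z i) 0) * (∑ j ∈ S, c j * max (y j - z j) 0) * (∑ k ∈ S, c k) := by
      rw [hc1, mul_one]
    rw [e1, e2, triple_expand, triple_expand, triple_expand, ← Finset.sum_add_distrib, ← Finset.sum_sub_distrib]
    refine Finset.sum_congr rfl (fun i _ => ?_)
    rw [← Finset.sum_add_distrib, ← Finset.sum_sub_distrib]
    refine Finset.sum_congr rfl (fun j _ => ?_)
    rw [← Finset.sum_add_distrib, ← Finset.sum_sub_distrib]
    refine Finset.sum_congr rfl (fun k _ => ?_)
    simp only [hφ]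
    ring
  rw [step1]
  -- Step 2: symmetrise and use LEMMA Φ termwise
  have step2 : 0 ≤ 6 * ∑ i ∈ S, ∑ j ∈ S, ∑ k ∈ S, φ i j k := by
    rw [triple_sum_symm]
    refine Finset.sum_nonneg (fun i _ => Finset.sum_nonneg (fun j _ => Finset.sum_nonneg (fun k _ => ?_)))
    have hcc : 0 ≤ c i * c j * c k := mul_nonneg (mul_nonneg (hc i) (hc j)) (hc k)
    -- the symmetrised summand is `c i c j c k · Φ(P_i,P_j,P_k)`; sort the three indices and apply `phi3_nonneg`
    rcases le_total i j with hij | hji <;> rcases le_total j k with hjk | hkj <;> rcases le_total i k with hik | hki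
    · have h := phi3_nonneg (x i) (x j) (x k) (y i) (y j) (y k) (z i) (z j) (z k) (hx hij) (hx hjk) (hy hij) (hy hjk)
        (hz hij) (hz hjk) (hx0 i) (hy0 i) (hz0 i) (hx1 k) (hy1 k) (hz1 k)
      simp only [hφ]; linarith [mul_nonneg hcc h]
    · have h := phi3_nonneg (x i) (x j) (x k) (y i) (y j) (y k) (z i) (z j) (z k) (hx hij) (hx hjk) (hy hij) (hy hjk)
        (hz hij) (hz hjk) (hx0 i) (hy0 i) (hz0 i) (hx1 k) (hy1 k) (hz1 k)
      simp only [hφ]; linarith [mul_nonneg hcc h]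
    · have h := phi3_nonneg (x i) (x k) (x j) (y i) (y k) (y j) (z i) (z k) (z j) (hx hik) (hx hkj) (hy hik) (hy hkj)
        (hz hik) (hz hkj) (hx0 i) (hy0 i) (hz0 i) (hx1 j) (hy1 j) (hz1 j)
      simp only [hφ]; linarith [mul_nonneg hcc h]
    · have h := phi3_nonneg (x k) (x i) (x j) (y k) (y i) (y j) (z k) (z i) (z j) (hx hki) (hx hij) (hy hki) (hy hij)
        (hz hki) (hz hij) (hx0 k) (hy0 k) (hz0 k) (hx1 j) (hy1 j) (hz1 j)
      simp only [hφ]; linarith [mul_nonneg hcc h]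
    · have h := phi3_nonneg (x j) (x i) (x k) (y j) (y i) (y k) (z j) (z i) (z k) (hx hji) (hx hik) (hy hji) (hy hik)
        (hz hji) (hz hik) (hx0 j) (hy0 j) (hz0 j) (hx1 k) (hy1 k) (hz1 k)
      simp only [hφ]; linarith [mul_nonneg hcc h]
    · have h := phi3_nonneg (x j) (x k) (x i) (y j) (y k) (y i) (z j) (z k) (z i) (hx hjk) (hx hki) (hy hjk) (hy hki)
        (hz hjk) (hz hki) (hx0 j) (hy0 j) (hz0 j) (hx1 i) (hy1 i) (hz1 i)
      simp only [hφ]; linarith [mul_nonneg hcc h]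
    · have h := phi3_nonneg (x j) (x i) (x k) (y j) (y i) (y k) (z j) (z i) (z k) (hx hji) (hx hik) (hy hji) (hy hik)
        (hz hji) (hz hik) (hx0 j) (hy0 j) (hz0 j) (hx1 k) (hy1 k) (hz1 k)
      simp only [hφ]; linarith [mul_nonneg hcc h]
    · have h := phi3_nonneg (x k) (x j) (x i) (y k) (y j) (y i) (z k) (z j) (z i) (hx hkj) (hx hji) (hy hkj) (hy hji)
        (hz hkj) (hz hji) (hx0 k) (hy0 k) (hz0 k) (hx1 i) (hy1 i) (hz1 i)
      simp only [hφ]; linarith [mul_nonneg hcc h]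
  linarith

end TwoChain

end SahiOneStep

end Summit.CriticalPhenomena.PercolationContinuityZ3.Theorems
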